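/-
Copyright (c) 2026 the pub-hodgecm-mathlib formalisation cell (harness21).  Prover seat hodgecm-mathlib-K2Liu-p02 (g9), Track B «K2-LIT» ∕ hLiu418
#184♮, Road I v3, unit U5 «THE CLOSE», FACE-D₀ row `h2₂`: the (B1c′) tie's ADDITIVITY INPUT and the `ρf`∕`hρf` ∃-PACKAGE at the line Cayley mover
(chain desk word 2026-09-05T01:29Z; K2E3-p23 (g8) S-letter ledger 01:28:55Z).  THEOREMS ONLY.
-/
import Summits.HodgeConjecture.HodgeConjecture.Theorems.K2LiuLinePairCayleySiegelUnipotent     -- ★ p863869 (F0P2-p10 FILE 2c): `aMat_cMat_lineKappa_of_mem_unipDelta` (closed form of `c_q`)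
import Summits.HodgeConjecture.HodgeConjecture.Theorems.K2LiuFinChirpLocalReading              -- ★ p863696 (K2E3-p23): `exists_representation_finMulLM_finSdChar`
import Summits.HodgeConjecture.HodgeConjecture.Theorems.K2LiuSiegelUnipotentCharacters           -- ★ `toBlocks₁₂_blk_mul`
import HarnessLib

/-!
# K2_Liu road (hLiu418 = stmt-HodgeConjecture-24832), FACE-D₀ row `h2₂`: THE CHIRP PARAMETER OF THE LINE CAYLEY MOVER IS ADDITIVE ON `N_Δ(𝔸)`,
# AND THE `ρf`∕`hρf` PACKAGE OF THE (B1c′) TIE FOR EVERY HOMOMORPHISM INTO `N_Δ(𝔸)`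

Cell `pub/hodgecm-mathlib` (D-0151), Track B, build stream 29; helper lane `--supports stmt-HodgeConjecture-24832 --as helper`, count-neutral.

For `u ∈ N_Δ(𝔸)` let `q_u := ratSp κ′ · ι(u ⊗ 1) · (ratSp κ′)⁻¹ ∈ P_𝕐(T₁)` (F0P2-p10's line Cayley mover `κ′`, ★ p863784∕p863828∕p863869) and `c_{q_u}` its chirp parameter
(★ `aMat_cMat_lineKappa_of_mem_unipDelta`: a CLOSED FORM, linear in the frame coordinate `X_u = (blk u)₁₂` through `re`∕`im`).  Since `X_{uv} = X_u + X_v` on `N_Δ(𝔸)`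
(★ `toBlocks₁₂_blk_mul`):
* §1 **`cMat_lineKappa_mul`** `c_{q_{uv}} = c_{q_u} + c_{q_v}`; `cMat_lineKappa_one` `c_{q_1} = 0`; `smul_cMat_lineKappa_map_snd_mul∕_one` for the finite parts of
  `S_u := (−⅟2) • c_{q_u}`;
* §2 **`exists_rho_f`** — for ANY homomorphism `ι : Z →* H(𝔸)` with values in `N_Δ(𝔸)`, the `ρf`∕`hρf` letters of ★ p864051 `h2Row_thetaSide_of_lineCayley_fst`:
  `∃ ρf : Representation ℂ Z (𝒮(𝔸_f^{n″})), ∀ z φ, ρf z φ = finMulLM (finSdChar ((S_{ι z})_f)) φ` (★ p863696 `exists_representation_finMulLM_finSdChar` on §1) — at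
  K2E3-p23's instance `ι := (locToAdelic … v).comp (unipDeltaLoc … v).subtype`.

No definition, no instance, no notation, no named-fact hypothesis, no `sorry`; axioms ⊆ {propext, Classical.choice, Quot.sound}.  HONEST LABEL: HC_CM is proved
only modulo the 7 printed citations (2 remaining named inputs: hLiu418 = stmt-HodgeConjecture-24832, h413 = stmt-HodgeConjecture-24833) until rung 0 closes; this file
moves no counter.

References: [Weil1964] A. Weil, Acta Math. 111 (1964), Chap. I n° 2 p. 146, n° 13 p. 160, n° 34 p. 184, Chap. III n° 46 p. 202; [Kudla1994] S. S. Kudla, Israel J.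
Math. 87 (1994), §3; [MoeglinWaldspurger1995] I.2.1; [Liu2021] App. B Prop. B.8 p. 104.
-/

set_option autoImplicit false
set_option linter.dupNamespace false
set_option Elab.async false

noncomputable section

open NumberField NumberField.mixedEmbedding IsDedekindDomain
open scoped Matrix TensorProduct SchwartzMap Classical

namespace Summit.HodgeConjecture.HodgeConjecture.Cruxes.HLiu418.K2LiuLinePairChirpAdditive

open Literature.NumberTheory.Automorphic Literature.NumberTheory.Automorphic.UnitaryGroup
open Literature.NumberTheory.Automorphic.UnitaryGroup.QuadraticCoordinates
open Literature.NumberTheory.Automorphic.Liu2021 Literature.NumberTheory.Automorphic.Liu2021.Def411WeilCarriers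
open Literature.NumberTheory.GelbartRogawski1991 Literature.NumberTheory.GelbartRogawski1991.UnitaryDualPair
open Literature.NumberTheory.GelbartRogawski1991.GRConstruction
open Literature.NumberTheory.GaloisRepresentations
open Literature.NumberTheory.Weil1964
open Literature.RepresentationTheory.HeisenbergGroup
open Literature.NumberTheory.K2Lit.DoubledLineTheta Literature.NumberTheory.K2Lit.SiegelDoubled
open Summit.HodgeConjecture.HodgeConjecture.Cruxes.HLiu418.K2LiuSiegelUnipotentCharacters (toBlocks₁₂_blk_mul)
open Summit.HodgeConjecture.HodgeConjecture.Cruxes.HLiu418.K2LiuLinePairCayleySiegel (lineCayleyMover_mem_symplecticGroup)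
open Summit.HodgeConjecture.HodgeConjecture.Cruxes.HLiu418.K2LiuLinePairCayleySiegelUnipotent (aMat_cMat_lineKappa_of_mem_unipDelta)
open Summit.HodgeConjecture.HodgeConjecture.Cruxes.HLiu418.K2LiuFinChirpLocalReading (exists_representation_finMulLM_finSdChar)

variable (L : Type) [Field L] [NumberField L] [IsCMField L]
variable {N M n : ℕ} (e : Fin N × Fin M ≃ Fin n)
  (dV : Fin N → L) (hdV : ∀ i, IsCMField.complexConj L (dV i) = dV i)
  (dW : Fin M → L) (hdW : ∀ i, IsCMField.complexConj L (dW i) = dW i)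
  {n'' : ℕ} (e₁ : Fin (n + n) × Fin 1 ≃ Fin n'') (hdV0 : ∀ i, dV i ≠ 0) (hdW0 : ∀ i, dW i ≠ 0) (a' : (Fp L)ˣ)

/-! ## §1 Additivity of the chirp parameter on `N_Δ(𝔸)` -/

/-- the closed-form block of ★ `aMat_cMat_lineKappa_of_mem_unipDelta` is ADDITIVE in the frame coordinate (pure block algebra: `re`, `im` are additive, the
blocks are linear). [cite: Weil1964, Chap. III n° 46 p. 202] -/
theorem chirpBlock_add (Y₁ Y₂ : Matrix (Fin n) (Fin n) (AdeleRing (𝓞 L) L)) :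
    Matrix.fromBlocks 0 1 (-((2 : (AdeleRing (𝓞 (Fp L)) (Fp L))) • 1)) 0 *
        Matrix.fromBlocks ((Y₁ + Y₂).map (re (quadraticAdeleEquiv (Fp L) L (IsCMField.complexConj L) (complexConj_imagUnit L) (imagUnit_ne_zero L)).toAddEquiv))
          ((algebraMap (Fp L) (AdeleRing (𝓞 (Fp L)) (Fp L)) (imagUnitSq L)) • ((Y₁ + Y₂).map (im (quadraticAdeleEquiv (Fp L) L (IsCMField.complexConj L) (complexConj_imagUnit L) (imagUnit_ne_zero L)).toAddEquiv) * ((gramR L e dV hdV dW hdW).map (algebraMap (Fp L) (AdeleRing (𝓞 (Fp L)) (Fp L))))⁻¹))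
          (((gramR L e dV hdV dW hdW).map (algebraMap (Fp L) (AdeleRing (𝓞 (Fp L)) (Fp L)))) * (Y₁ + Y₂).map (im (quadraticAdeleEquiv (Fp L) L (IsCMField.complexConj L) (complexConj_imagUnit L) (imagUnit_ne_zero L)).toAddEquiv))
          (((gramR L e dV hdV dW hdW).map (algebraMap (Fp L) (AdeleRing (𝓞 (Fp L)) (Fp L)))) * (Y₁ + Y₂).map (re (quadraticAdeleEquiv (Fp L) L (IsCMField.complexConj L) (complexConj_imagUnit L) (imagUnit_ne_zero L)).toAddEquiv) * ((gramR L e dV hdV dW hdW).map (algebraMap (Fp L) (AdeleRing (𝓞 (Fp L)) (Fp L))))⁻¹) *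
        Matrix.fromBlocks ((⅟(2 : (AdeleRing (𝓞 (Fp L)) (Fp L)))) • 1) 0 0 1 =
      Matrix.fromBlocks 0 1 (-((2 : (AdeleRing (𝓞 (Fp L)) (Fp L))) • 1)) 0 *
          Matrix.fromBlocks (Y₁.map (re (quadraticAdeleEquiv (Fp L) L (IsCMField.complexConj L) (complexConj_imagUnit L) (imagUnit_ne_zero L)).toAddEquiv))
            ((algebraMap (Fp L) (AdeleRing (𝓞 (Fp L)) (Fp L)) (imagUnitSq L)) • (Y₁.map (im (quadraticAdeleEquiv (Fp L) L (IsCMField.complexConj L) (complexConj_imagUnit L) (imagUnit_ne_zero L)).toAddEquiv) * ((gramR L e dV hdV dW hdW).map (algebraMap (Fp L) (AdeleRing (𝓞 (Fp L)) (Fp L))))⁻¹))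
            (((gramR L e dV hdV dW hdW).map (algebraMap (Fp L) (AdeleRing (𝓞 (Fp L)) (Fp L)))) * Y₁.map (im (quadraticAdeleEquiv (Fp L) L (IsCMField.complexConj L) (complexConj_imagUnit L) (imagUnit_ne_zero L)).toAddEquiv))
            (((gramR L e dV hdV dW hdW).map (algebraMap (Fp L) (AdeleRing (𝓞 (Fp L)) (Fp L)))) * Y₁.map (re (quadraticAdeleEquiv (Fp L) L (IsCMField.complexConj L) (complexConj_imagUnit L) (imagUnit_ne_zero L)).toAddEquiv) * ((gramR L e dV hdV dW hdW).map (algebraMap (Fp L) (AdeleRing (𝓞 (Fp L)) (Fp L))))⁻¹) *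
          Matrix.fromBlocks ((⅟(2 : (AdeleRing (𝓞 (Fp L)) (Fp L)))) • 1) 0 0 1 +
        Matrix.fromBlocks 0 1 (-((2 : (AdeleRing (𝓞 (Fp L)) (Fp L))) • 1)) 0 *
          Matrix.fromBlocks (Y₂.map (re (quadraticAdeleEquiv (Fp L) L (IsCMField.complexConj L) (complexConj_imagUnit L) (imagUnit_ne_zero L)).toAddEquiv))
            ((algebraMap (Fp L) (AdeleRing (𝓞 (Fp L)) (Fp L)) (imagUnitSq L)) • (Y₂.map (im (quadraticAdeleEquiv (Fp L) L (IsCMField.complexConj L) (complexConj_imagUnit L) (imagUnit_ne_zero L)).toAddEquiv) * ((gramR L e dV hdV dW hdW).map (algebraMap (Fp L) (AdeleRing (𝓞 (Fp L)) (Fp L))))⁻¹))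
            (((gramR L e dV hdV dW hdW).map (algebraMap (Fp L) (AdeleRing (𝓞 (Fp L)) (Fp L)))) * Y₂.map (im (quadraticAdeleEquiv (Fp L) L (IsCMField.complexConj L) (complexConj_imagUnit L) (imagUnit_ne_zero L)).toAddEquiv))
            (((gramR L e dV hdV dW hdW).map (algebraMap (Fp L) (AdeleRing (𝓞 (Fp L)) (Fp L)))) * Y₂.map (re (quadraticAdeleEquiv (Fp L) L (IsCMField.complexConj L) (complexConj_imagUnit L) (imagUnit_ne_zero L)).toAddEquiv) * ((gramR L e dV hdV dW hdW).map (algebraMap (Fp L) (AdeleRing (𝓞 (Fp L)) (Fp L))))⁻¹) *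
          Matrix.fromBlocks ((⅟(2 : (AdeleRing (𝓞 (Fp L)) (Fp L)))) • 1) 0 0 1 := by
  rw [Matrix.map_add _ (map_add _), Matrix.map_add _ (map_add _), ← Matrix.add_mul, ← Matrix.mul_add, Matrix.fromBlocks_add]
  simp only [smul_add, Matrix.add_mul, Matrix.mul_add]

set_option maxHeartbeats 1000000 in -- the statement carries the line datum's `toSp` term three times (default RED measured, as ★ p863869's 800000)
/-- **`c_{q_{uv}} = c_{q_u} + c_{q_v}` on `N_Δ(𝔸)`**: the chirp parameter of the line Cayley mover is additive (★ closed form + `X_{uv} = X_u + X_v`, ★ `toBlocks₁₂_blk_mul`).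
[cite: Weil1964, Chap. III n° 46 p. 202] [cite: Kudla1994, §3] [cite: MoeglinWaldspurger1995, I.2.1] -/
theorem cMat_lineKappa_mul {u v : HA L e dV hdV dW hdW} (hu : u ∈ unipDelta L e dV hdV dW hdW) (hv : v ∈ unipDelta L e dV hdV dW hdW) :
    SiegelParabolicPi.cMat (ratSp (Fp L) (adelicGram (Fp L) e₁ (realDiagonal L (dD L e dV hdV dW hdW) (dD_conj L e dV hdV dW hdW)) (TW (Fp L) a'))
          (isUnit_det_adelicGram (Fp L) e₁
            (isUnit_det_realDiagonal L (dD L e dV hdV dW hdW) (dD_conj L e dV hdV dW hdW) (dD_ne_zero L e dV hdV dW hdW hdV0 hdW0))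
            (isUnit_det_TW (Fp L) a')) (⟨_, lineCayleyMover_mem_symplecticGroup (Fp L) n ((Equiv.prodUnique (Fin (n + n)) (Fin 1)).symm.trans e₁) (Units.mul_inv a')⟩ :
            Matrix.symplecticGroup (Fin n'') (Fp L)) *
        toSp (Fp L) L (IsCMField.complexConj L) (n + n) 1 e₁ (Matrix.diagonal (dD L e dV hdV dW hdW)) (JW (Fp L) L a')
          (complexConj_imagUnit L) (imagUnit_ne_zero L) (imagUnit_mul_self L)
          (realDiagonal_isSymm L (dD L e dV hdV dW hdW) (dD_conj L e dV hdV dW hdW)) (isSymm_TW (Fp L) a')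
          (realDiagonal_map L (dD L e dV hdV dW hdW) (dD_conj L e dV hdV dW hdW)).symm (JW_eq (Fp L) L a')
          (UnitaryGroup.adelicInl (Fp L) L (IsCMField.complexConj L) (n + n) 1 (Matrix.diagonal (dD L e dV hdV dW hdW)) (JW (Fp L) L a')
            (toDiagA L e dV hdV dW hdW (u * v))) *
        (ratSp (Fp L) (adelicGram (Fp L) e₁ (realDiagonal L (dD L e dV hdV dW hdW) (dD_conj L e dV hdV dW hdW)) (TW (Fp L) a'))
          (isUnit_det_adelicGram (Fp L) e₁
            (isUnit_det_realDiagonal L (dD L e dV hdV dW hdW) (dD_conj L e dV hdV dW hdW) (dD_ne_zero L e dV hdV dW hdW hdV0 hdW0))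
            (isUnit_det_TW (Fp L) a')) (⟨_, lineCayleyMover_mem_symplecticGroup (Fp L) n ((Equiv.prodUnique (Fin (n + n)) (Fin 1)).symm.trans e₁) (Units.mul_inv a')⟩ :
            Matrix.symplecticGroup (Fin n'') (Fp L)))⁻¹) =
      SiegelParabolicPi.cMat (ratSp (Fp L) (adelicGram (Fp L) e₁ (realDiagonal L (dD L e dV hdV dW hdW) (dD_conj L e dV hdV dW hdW)) (TW (Fp L) a'))
          (isUnit_det_adelicGram (Fp L) e₁
            (isUnit_det_realDiagonal L (dD L e dV hdV dW hdW) (dD_conj L e dV hdV dW hdW) (dD_ne_zero L e dV hdV dW hdW hdV0 hdW0))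
            (isUnit_det_TW (Fp L) a')) (⟨_, lineCayleyMover_mem_symplecticGroup (Fp L) n ((Equiv.prodUnique (Fin (n + n)) (Fin 1)).symm.trans e₁) (Units.mul_inv a')⟩ :
            Matrix.symplecticGroup (Fin n'') (Fp L)) *
        toSp (Fp L) L (IsCMField.complexConj L) (n + n) 1 e₁ (Matrix.diagonal (dD L e dV hdV dW hdW)) (JW (Fp L) L a')
          (complexConj_imagUnit L) (imagUnit_ne_zero L) (imagUnit_mul_self L)
          (realDiagonal_isSymm L (dD L e dV hdV dW hdW) (dD_conj L e dV hdV dW hdW)) (isSymm_TW (Fp L) a')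
          (realDiagonal_map L (dD L e dV hdV dW hdW) (dD_conj L e dV hdV dW hdW)).symm (JW_eq (Fp L) L a')
          (UnitaryGroup.adelicInl (Fp L) L (IsCMField.complexConj L) (n + n) 1 (Matrix.diagonal (dD L e dV hdV dW hdW)) (JW (Fp L) L a')
            (toDiagA L e dV hdV dW hdW u)) *
        (ratSp (Fp L) (adelicGram (Fp L) e₁ (realDiagonal L (dD L e dV hdV dW hdW) (dD_conj L e dV hdV dW hdW)) (TW (Fp L) a'))
          (isUnit_det_adelicGram (Fp L) e₁
            (isUnit_det_realDiagonal L (dD L e dV hdV dW hdW) (dD_conj L e dV hdV dW hdW) (dD_ne_zero L e dV hdV dW hdW hdV0 hdW0))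
            (isUnit_det_TW (Fp L) a')) (⟨_, lineCayleyMover_mem_symplecticGroup (Fp L) n ((Equiv.prodUnique (Fin (n + n)) (Fin 1)).symm.trans e₁) (Units.mul_inv a')⟩ :
            Matrix.symplecticGroup (Fin n'') (Fp L)))⁻¹) +
        SiegelParabolicPi.cMat (ratSp (Fp L) (adelicGram (Fp L) e₁ (realDiagonal L (dD L e dV hdV dW hdW) (dD_conj L e dV hdV dW hdW)) (TW (Fp L) a'))
          (isUnit_det_adelicGram (Fp L) e₁
            (isUnit_det_realDiagonal L (dD L e dV hdV dW hdW) (dD_conj L e dV hdV dW hdW) (dD_ne_zero L e dV hdV dW hdW hdV0 hdW0))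
            (isUnit_det_TW (Fp L) a')) (⟨_, lineCayleyMover_mem_symplecticGroup (Fp L) n ((Equiv.prodUnique (Fin (n + n)) (Fin 1)).symm.trans e₁) (Units.mul_inv a')⟩ :
            Matrix.symplecticGroup (Fin n'') (Fp L)) *
        toSp (Fp L) L (IsCMField.complexConj L) (n + n) 1 e₁ (Matrix.diagonal (dD L e dV hdV dW hdW)) (JW (Fp L) L a')
          (complexConj_imagUnit L) (imagUnit_ne_zero L) (imagUnit_mul_self L)
          (realDiagonal_isSymm L (dD L e dV hdV dW hdW) (dD_conj L e dV hdV dW hdW)) (isSymm_TW (Fp L) a')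
          (realDiagonal_map L (dD L e dV hdV dW hdW) (dD_conj L e dV hdV dW hdW)).symm (JW_eq (Fp L) L a')
          (UnitaryGroup.adelicInl (Fp L) L (IsCMField.complexConj L) (n + n) 1 (Matrix.diagonal (dD L e dV hdV dW hdW)) (JW (Fp L) L a')
            (toDiagA L e dV hdV dW hdW v)) *
        (ratSp (Fp L) (adelicGram (Fp L) e₁ (realDiagonal L (dD L e dV hdV dW hdW) (dD_conj L e dV hdV dW hdW)) (TW (Fp L) a'))
          (isUnit_det_adelicGram (Fp L) e₁
            (isUnit_det_realDiagonal L (dD L e dV hdV dW hdW) (dD_conj L e dV hdV dW hdW) (dD_ne_zero L e dV hdV dW hdW hdV0 hdW0))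
            (isUnit_det_TW (Fp L) a')) (⟨_, lineCayleyMover_mem_symplecticGroup (Fp L) n ((Equiv.prodUnique (Fin (n + n)) (Fin 1)).symm.trans e₁) (Units.mul_inv a')⟩ :
            Matrix.symplecticGroup (Fin n'') (Fp L)))⁻¹) := by
  rw [(aMat_cMat_lineKappa_of_mem_unipDelta L e dV hdV hdV0 dW hdW hdW0 e₁ a' (isUnit_det_adelicGram (Fp L) e₁
            (isUnit_det_realDiagonal L (dD L e dV hdV dW hdW) (dD_conj L e dV hdV dW hdW) (dD_ne_zero L e dV hdV dW hdW hdV0 hdW0))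
            (isUnit_det_TW (Fp L) a'))
    (JW (Fp L) L a') (realDiagonal_isSymm L (dD L e dV hdV dW hdW) (dD_conj L e dV hdV dW hdW)) (isSymm_TW (Fp L) a')
    (realDiagonal_map L (dD L e dV hdV dW hdW) (dD_conj L e dV hdV dW hdW)).symm (JW_eq (Fp L) L a') (mul_mem hu hv)).2,
    (aMat_cMat_lineKappa_of_mem_unipDelta L e dV hdV hdV0 dW hdW hdW0 e₁ a' (isUnit_det_adelicGram (Fp L) e₁
            (isUnit_det_realDiagonal L (dD L e dV hdV dW hdW) (dD_conj L e dV hdV dW hdW) (dD_ne_zero L e dV hdV dW hdW hdV0 hdW0))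
            (isUnit_det_TW (Fp L) a'))
    (JW (Fp L) L a') (realDiagonal_isSymm L (dD L e dV hdV dW hdW) (dD_conj L e dV hdV dW hdW)) (isSymm_TW (Fp L) a')
    (realDiagonal_map L (dD L e dV hdV dW hdW) (dD_conj L e dV hdV dW hdW)).symm (JW_eq (Fp L) L a') hu).2,
    (aMat_cMat_lineKappa_of_mem_unipDelta L e dV hdV hdV0 dW hdW hdW0 e₁ a' (isUnit_det_adelicGram (Fp L) e₁
            (isUnit_det_realDiagonal L (dD L e dV hdV dW hdW) (dD_conj L e dV hdV dW hdW) (dD_ne_zero L e dV hdV dW hdW hdV0 hdW0))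
            (isUnit_det_TW (Fp L) a'))
    (JW (Fp L) L a') (realDiagonal_isSymm L (dD L e dV hdV dW hdW) (dD_conj L e dV hdV dW hdW)) (isSymm_TW (Fp L) a')
    (realDiagonal_map L (dD L e dV hdV dW hdW) (dD_conj L e dV hdV dW hdW)).symm (JW_eq (Fp L) L a') hv).2,
    toBlocks₁₂_blk_mul L e dV hdV dW hdW hu hv]
  -- freeze the two coordinates (`blk` is a `reindex`; `Matrix.reindex_apply` would unfold it)
  generalize (blk L e dV hdV dW hdW u).toBlocks₁₂ = A
  generalize (blk L e dV hdV dW hdW v).toBlocks₁₂ = B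
  have hY : -(A + B) - (A + B) = (-A - A) + (-B - B) := by abel
  rw [hY, chirpBlock_add, smul_add]
  simp only [Matrix.reindex_apply, Matrix.submatrix_add, Pi.add_apply, Matrix.mul_add]

set_option maxHeartbeats 1000000 in -- idem
/-- **`c_{q_1} = 0`** (`c_{q_1} = c_{q_1} + c_{q_1}` by `cMat_lineKappa_mul`). [cite: Weil1964, Chap. III n° 46 p. 202] -/
theorem cMat_lineKappa_one :
    SiegelParabolicPi.cMat (ratSp (Fp L) (adelicGram (Fp L) e₁ (realDiagonal L (dD L e dV hdV dW hdW) (dD_conj L e dV hdV dW hdW)) (TW (Fp L) a'))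
          (isUnit_det_adelicGram (Fp L) e₁
            (isUnit_det_realDiagonal L (dD L e dV hdV dW hdW) (dD_conj L e dV hdV dW hdW) (dD_ne_zero L e dV hdV dW hdW hdV0 hdW0))
            (isUnit_det_TW (Fp L) a')) (⟨_, lineCayleyMover_mem_symplecticGroup (Fp L) n ((Equiv.prodUnique (Fin (n + n)) (Fin 1)).symm.trans e₁) (Units.mul_inv a')⟩ :
            Matrix.symplecticGroup (Fin n'') (Fp L)) *
        toSp (Fp L) L (IsCMField.complexConj L) (n + n) 1 e₁ (Matrix.diagonal (dD L e dV hdV dW hdW)) (JW (Fp L) L a')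
          (complexConj_imagUnit L) (imagUnit_ne_zero L) (imagUnit_mul_self L)
          (realDiagonal_isSymm L (dD L e dV hdV dW hdW) (dD_conj L e dV hdV dW hdW)) (isSymm_TW (Fp L) a')
          (realDiagonal_map L (dD L e dV hdV dW hdW) (dD_conj L e dV hdV dW hdW)).symm (JW_eq (Fp L) L a')
          (UnitaryGroup.adelicInl (Fp L) L (IsCMField.complexConj L) (n + n) 1 (Matrix.diagonal (dD L e dV hdV dW hdW)) (JW (Fp L) L a')
            (toDiagA L e dV hdV dW hdW 1)) *
        (ratSp (Fp L) (adelicGram (Fp L) e₁ (realDiagonal L (dD L e dV hdV dW hdW) (dD_conj L e dV hdV dW hdW)) (TW (Fp L) a'))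
          (isUnit_det_adelicGram (Fp L) e₁
            (isUnit_det_realDiagonal L (dD L e dV hdV dW hdW) (dD_conj L e dV hdV dW hdW) (dD_ne_zero L e dV hdV dW hdW hdV0 hdW0))
            (isUnit_det_TW (Fp L) a')) (⟨_, lineCayleyMover_mem_symplecticGroup (Fp L) n ((Equiv.prodUnique (Fin (n + n)) (Fin 1)).symm.trans e₁) (Units.mul_inv a')⟩ :
            Matrix.symplecticGroup (Fin n'') (Fp L)))⁻¹) = 0 := by
  have h := cMat_lineKappa_mul L e dV hdV dW hdW e₁ hdV0 hdW0 a' (one_mem (unipDelta L e dV hdV dW hdW)) (one_mem (unipDelta L e dV hdV dW hdW))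
  rw [mul_one] at h
  exact left_eq_add.mp h

/-! ## §2 The `ρf`∕`hρf` ∃-package for every homomorphism into `N_Δ(𝔸)` -/

set_option maxHeartbeats 1000000 in -- idem
/-- **THE `ρf`∕`hρf` LETTERS OF ★ p864051 `h2Row_thetaSide_of_lineCayley_fst`**, for ANY homomorphism `ι : Z →* H(𝔸)` with values in `N_Δ(𝔸)`: there is a
representation `ρf` of `Z` on `𝒮(𝔸_f^{n″})` acting by the finite chirps of `S_{ι z} := (−⅟2) • c_{q_{ι z}}` — ★ p863696 `exists_representation_finMulLM_finSdChar` on the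
additive family `z ↦ (S_{ι z})_f` (§1).  At K2E3-p23's instance `ι := (locToAdelic … v).comp (unipDeltaLoc … v).subtype`.
[cite: Weil1964, Chap. I n° 34 p. 184] [cite: Kudla1994, §3] [cite: Liu2021, App. B Prop. B.8 p. 104] -/
theorem exists_rho_f {Z : Type*} [Group Z] (ι : Z →* HA L e dV hdV dW hdW) (hι : ∀ z, ι z ∈ unipDelta L e dV hdV dW hdW) :
    ∃ ρf : Representation ℂ Z (FinSB (Fp L) (Fin n'')), ∀ (z : Z) (φ : FinSB (Fp L) (Fin n'')), ρf z φ =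
      finMulLM (finSdChar ((((-⅟(2 : AdeleRing (𝓞 (Fp L)) (Fp L))) • SiegelParabolicPi.cMat (ratSp (Fp L) (adelicGram (Fp L) e₁ (realDiagonal L (dD L e dV hdV dW hdW) (dD_conj L e dV hdV dW hdW)) (TW (Fp L) a'))
          (isUnit_det_adelicGram (Fp L) e₁
            (isUnit_det_realDiagonal L (dD L e dV hdV dW hdW) (dD_conj L e dV hdV dW hdW) (dD_ne_zero L e dV hdV dW hdW hdV0 hdW0))
            (isUnit_det_TW (Fp L) a')) (⟨_, lineCayleyMover_mem_symplecticGroup (Fp L) n ((Equiv.prodUnique (Fin (n + n)) (Fin 1)).symm.trans e₁) (Units.mul_inv a')⟩ :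
            Matrix.symplecticGroup (Fin n'') (Fp L)) *
        toSp (Fp L) L (IsCMField.complexConj L) (n + n) 1 e₁ (Matrix.diagonal (dD L e dV hdV dW hdW)) (JW (Fp L) L a')
          (complexConj_imagUnit L) (imagUnit_ne_zero L) (imagUnit_mul_self L)
          (realDiagonal_isSymm L (dD L e dV hdV dW hdW) (dD_conj L e dV hdV dW hdW)) (isSymm_TW (Fp L) a')
          (realDiagonal_map L (dD L e dV hdV dW hdW) (dD_conj L e dV hdV dW hdW)).symm (JW_eq (Fp L) L a')
          (UnitaryGroup.adelicInl (Fp L) L (IsCMField.complexConj L) (n + n) 1 (Matrix.diagonal (dD L e dV hdV dW hdW)) (JW (Fp L) L a')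
            (toDiagA L e dV hdV dW hdW (ι z))) *
        (ratSp (Fp L) (adelicGram (Fp L) e₁ (realDiagonal L (dD L e dV hdV dW hdW) (dD_conj L e dV hdV dW hdW)) (TW (Fp L) a'))
          (isUnit_det_adelicGram (Fp L) e₁
            (isUnit_det_realDiagonal L (dD L e dV hdV dW hdW) (dD_conj L e dV hdV dW hdW) (dD_ne_zero L e dV hdV dW hdW hdV0 hdW0))
            (isUnit_det_TW (Fp L) a')) (⟨_, lineCayleyMover_mem_symplecticGroup (Fp L) n ((Equiv.prodUnique (Fin (n + n)) (Fin 1)).symm.trans e₁) (Units.mul_inv a')⟩ :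
            Matrix.symplecticGroup (Fin n'') (Fp L)))⁻¹))).map
        (RingHom.snd (InfiniteAdeleRing (Fp L)) (FiniteAdeleRing (𝓞 (Fp L)) (Fp L))))) (isLocallyConstant_finSdChar _) φ := by
  refine exists_representation_finMulLM_finSdChar (Fp L) _ ?_ fun z w => ?_
  · rw [map_one ι, cMat_lineKappa_one L e dV hdV dW hdW e₁ hdV0 hdW0 a', smul_zero]
    exact Matrix.ext fun _ _ => map_zero (RingHom.snd (InfiniteAdeleRing (Fp L)) (FiniteAdeleRing (𝓞 (Fp L)) (Fp L)))
  · rw [map_mul ι z w, cMat_lineKappa_mul L e dV hdV dW hdW e₁ hdV0 hdW0 a' (hι z) (hι w), smul_add]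
    exact Matrix.ext fun _ _ => map_add (RingHom.snd (InfiniteAdeleRing (Fp L)) (FiniteAdeleRing (𝓞 (Fp L)) (Fp L))) _ _

end Summit.HodgeConjecture.HodgeConjecture.Cruxes.HLiu418.K2LiuLinePairChirpAdditive

end
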